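import Literature.Computability.QuantumComplexity.DecisionDiagrams
import Literature.Computability.QuantumComplexity.OutOfTimeOrderCorrelator
import Mathlib.Analysis.Normed.Algebra.Exponential
import Mathlib.Analysis.SpecialFunctions.Trigonometric.Series
import HarnessLib

/-!
# Pauli rotations in the Heisenberg picture: the branching rule of Pauli propagation / sparse Pauli dynamics

Topic `Literature/Computability/QuantumComplexity` (pub-qadeq lane).  The classical challengers of the
IBM-processor dynamics rows propagate an observable backwards through the circuit in the Pauli
basis: CLAIMS E-17 (Kim et al. 2023; status cell: "counters … Begušić–Gray–Chan Sci. Adv. 10,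
eadk4321 (2024) … Begušić–Gray–Chan 2024 SPD"), E-47 (Leviatan et al. arXiv:2607.24937: "sparse
Pauli-path simulations remain strongly truncation dependent despite extensive computations on
advanced GPUs and the Fugaku supercomputer", with "O(10¹²) Pauli strings on 12,888 Fugaku nodes"),
E-44 (Pauli-propagation baselines), and the Summit-side route `PauliFlat`.  This file fixes, in the
tree's register Pauli vocabulary (`pauliString`, `pauliCoeff`, the commutation sign `strSign`, the
product table `pauliString_mul` / `stringMul` / `stringPhase` of `DecisionDiagrams.lean`), the ONE
algebraic rule these methods iterate — how a Pauli rotation gate acts on a Pauli string — together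
with its elementary consequences that the rows' cost and error sentences rest on (2-branching,
`≤ 2^m` strings after `m` rotations, conservation of the coefficient 2-norm, the `ℓ₁` truncation
bound).

HONEST FRAMING: instance-level adjudication of specific advantage claims; no claim about BQP vs BPP
or the summit.  Exact finite matrix identities; nothing here says how many strings a PARTICULAR
circuit generates after truncation, how fast any implementation runs, or that any truncated
simulation is accurate.

## Sources (verbatim)

[BegusicGrayChan2024] T. Begušić, J. Gray, G. K.-L. Chan, *Fast and converged classical simulations
of evidence for the utility of quantum computing before fault tolerance*, Sci. Adv. 10, eadk4321
(2024) = arXiv:2308.05077, Results §"Sparse Pauli dynamics" (tex chunk p0004 of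
`lit read arxiv:2308.05077`): "The SPD approach … is based on representing a target observable in
the Heisenberg picture as a sum of Pauli operators `O = Σ_{P∈𝒫} a_P P` … A Pauli rotation gate
`U_σ(θ) = e^{−iθσ/2}`, defined by a real rotation angle `θ` and a Hermitian `n`-qubit Pauli operator
`σ`, transforms any `n`-qubit Pauli operator `P` according to
`U_σ(θ)† P U_σ(θ) = cos(θ) P + i sin(θ) σP` if `{σ,P} = 0`, `= P` if `[σ,P] = 0`. Consequently, for
each Pauli operator `P ∈ 𝒫` that anticommutes with `σ` of the rotation gate, the representation of
the observable `O` must be expanded to `𝒫′ = 𝒫 ∪ {σP}`. This will, in general, lead to an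
exponential growth of the number of terms in the sum."  Methods (chunk p0009): "Applying a
non-Clifford Pauli rotation gate `U_σ(θ)` to the observable `O = Σ_{P∈𝒫} a_P P` yields
`U_σ(θ)† O U_σ(θ) = Σ_{P∈𝒫′} a′_P P`, where the new set of Pauli operators is
`𝒫′ = 𝒫 ∪ {σP | P ∈ 𝒫, {σ,P} = 0}` and the updated coefficients are
`a′_P = a_P cos(θ) + i a_{σP} sin(θ)` (`{σ,P} = 0`), `a′_P = a_P` (`[σ,P] = 0`). In general,
`2|𝒫| ≥ |𝒫′| ≥ |𝒫|`, i.e., the number of Pauli operators representing the observable grows with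
each applied gate, leading to the worst-case scaling of `𝒪(2^N)`. … `Π_δ(Σ_{P∈𝒫} a′_P P) =
Σ_{P∈𝒫′} a_P P` so that `|a_P| ≥ δ` for all `P ∈ 𝒫′`. In words, the exact representation of the
observable is truncated after each gate to only include the terms whose coefficients are greater
than the prescribed threshold `δ`."

[RudolphEtAl2025] M. S. Rudolph, T. Jones, Y. Teng, A. Angrisani, Z. Holmes, *Pauli Propagation: A
Computational Framework for Simulating Quantum Systems*, arXiv:2505.21606 (2025), §II (PDF p. 3,
L75–85): "The action of an operation `E_l` onto a Pauli string `P` can generally be written as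
`E_l[P] = Σ_j c_j^{E_l} P_j` (4) … `N_{E_l,P}` is the number of non-zero coefficient Pauli strings in
the sum created from acting `E_l` onto Pauli `P`. We also call this number the branching factor";
§II B (p. 5, L27–43): "Pauli Rotations: Gates of the form `R_G(θ) = e^{−iθG/2}`, where the generator
`G` is an `n`-qubit Pauli string … A Pauli rotation is always either 1-branching (i.e.,
non-branching) or 2-branching … in the Heisenberg picture we have `R_G(θ)[P] := e^{iθG/2} P
e^{−iθG/2}` (13) such that for `θ ∈ ℝ` `R_G(θ)[P] = P` if `[P,G] = 0`, `cos(θ)P + sin(θ)P′` else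
(14) where `P′ = i[G,P]/2` is a new Pauli string. Given the 2-branching action of Pauli rotations,
a circuit composed of `m` Pauli rotations can generate up to `2^m` Pauli strings"; §III C (p. 13,
L55–56 and L103–105): "During unitary evolutions in Pauli propagation, the 2-norm of the observable
`O = Σ_α c_α P_α` – i.e. `2^{−n} Tr[O²] = Σ_α c_α²` – is conserved"; Theory Box 3 (p. 13): "We can
upper bound the truncation error via the triangle inequality:
`|Tr[(O_{L−1} − C_L†(O_L)) ρ_{L−1}]| ≤ Σ_{truncated Paulis} |c_α| =: Δ_L` (31)–(32) … the total error
is upper bounded by `Δ := Δ_L + Δ_{L−1} + ⋯ + Δ_1` (33)".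

Conventions.  The tree's coefficients are un-normalised, `pauliCoeff O S = Tr(P_S O)`, so the
printed `a_P = c_α = 2^{−n} pauliCoeff O P`.  "`σP`" in [BegusicGrayChan2024] is the operator
product; as a labelled string it is `stringPhase σ P • pauliString (stringMul σ P)`
(`pauliString_mul`), and the coefficient rule below carries that phase explicitly.

## Contents (all proved, 0 named facts)

* `pauliRot θ G = cos(θ/2)·1 − i sin(θ/2)·P_G` and **`exp_eq_pauliRot`**: this IS the matrix
  exponential `e^{−iθG/2}` (`NormedSpace.exp`, by the cosine/sine series and `P_G² = 1`);
  `pauliRot_mul_pauliRot` (one-parameter group), `conjTranspose_pauliRot` (`R(θ)† = R(−θ)`),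
  `conjTranspose_mul_self_pauliRot` / `mul_conjTranspose_self_pauliRot` (unitary).
* `rotConj θ G M = R_G(θ)† M R_G(θ)` (eq. (13)); **`rotConj_pauliString_of_comm`** /
  **`rotConj_pauliString_of_anticomm`** — eq. (14) / BGC's display: `P` if `[G,P] = 0`,
  `cos θ · P + i sin θ · GP` if `{G,P} = 0`; the general form `rotConj_pauliString` with the sign
  `strSign G P ∈ {±1}`; `I_smul_mul_eq_half_commutator` (`iGP = i[G,P]/2`),
  `I_smul_mul_eq_smul_stringMul`, `I_smul_mul_sq`, `conjTranspose_I_smul_mul`,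
  `I_mul_stringPhase_eq_or` ("`P′` is a new Pauli string": `iGP = ±P_{G·P}`, Hermitian, squares to 1).
* **`pauliCoeff_rotConj_of_comm`** / **`pauliCoeff_rotConj_of_anticomm`** — BGC's coefficient
  update `a′_P = a_P` / `a′_P = a_P cos θ + i a_{σP} sin θ` (with the phase of `σP` explicit:
  `Tr(P_T R†OR) = cos θ Tr(P_T O) + i sin θ · stringPhase T G · Tr(P_{G·T} O)`), from the general
  `pauliCoeff_rotConj`.
* `pauliSupport O` (the label set `𝒫`), **`pauliSupport_rotConj_subset`** (`𝒫′ ⊆ 𝒫 ∪ G·𝒫`),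
  **`card_pauliSupport_rotConj_le`** (`|𝒫′| ≤ 2|𝒫|`, "2-branching"),
  **`card_pauliSupport_rotConjList_le`** ("a circuit composed of `m` Pauli rotations can generate
  up to `2^m` Pauli strings": `|𝒫_m| ≤ 2^m |𝒫_0|`), `pauliSupport_pauliString_subset`.
* **`sum_norm_pauliCoeff_sq_rotConj`** — "the 2-norm … `Σ_α c_α²` – is conserved" (for any `O`,
  `Σ_S |Tr(P_S R†OR)|² = Σ_S |Tr(P_S O)|²`, via the tree's Parseval `sum_norm_pauliCoeff_sq`).
* `truncateTo K O` (keep the labels in `K`; BGC's `Π_δ` is `K = {P : |a_P| ≥ δ}`),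
  `pauliCoeff_truncateTo`, `sub_truncateTo_eq`, and **`norm_trace_sub_truncateTo_mul_le`** — Box 3
  eq. (31)–(32): for any `ρ` with `|Tr(P_S ρ)| ≤ 1` for all `S` (every density matrix),
  `|Tr[(O − Π_K O)ρ]| ≤ Σ_{S ∉ K} |c_S|`.

## Not here

Which strings a given circuit generates, merging data structures, Clifford recompilation, the
Monte-Carlo / average-case error estimates (Rudolph et al. §III C, Box 5), noise channels, and any
running time.  The lower bound "`|𝒫′| ≥ |𝒫|`" of [BegusicGrayChan2024] refers to the label set
`𝒫′ ⊇ 𝒫` before cancellations; after merging, coefficients can cancel (e.g. `O = sin θ·Z + cos θ·Y`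
under `R_X(θ)` has one term), so only the label-set inclusion and the upper bound are theorems here.
Searched `lean search 'pauliRotation|Pauli propagation|sparse Pauli dynamics|Begušić'`: the tree
had no Heisenberg-picture rotation rule in `Literature/` (a Summit-side sketch
`Summits/QuantumAdvantage/…/Cruxes/CompositeFrameBound/Ideator3Sketch.lean` states a flatness
consequence with `sorry`).
-/

noncomputable section

open Matrix Finset

namespace Literature.Computability.QuantumComplexity.PauliPropagation

open Literature.Computability.QuantumComplexity
open Literature.Computability.QuantumComplexity.PauliPath
open Literature.Computability.QuantumComplexity.OTOC

variable {ι : Type*} [Fintype ι] [DecidableEq ι]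

/-- The **Pauli rotation gate** `R_G(θ) = e^{−iθG/2}` in closed form, `cos(θ/2)·1 − i sin(θ/2)·P_G`
(`exp_eq_pauliRot` identifies it with the matrix exponential). [cite: RudolphEtAl2025, §II B eq. (13) (R_G(θ) = e^{−iθG/2})] [cite: BegusicGrayChan2024, Results §Sparse Pauli dynamics (U_σ(θ) = e^{−iθσ/2})] -/
def pauliRot (θ : ℝ) (G : ι → Pauli) : Matrix (ι → Bool) (ι → Bool) ℂ :=
  (Real.cos (θ / 2) : ℂ) • (1 : Matrix (ι → Bool) (ι → Bool) ℂ) -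
    (Complex.I * (Real.sin (θ / 2) : ℂ)) • pauliString G

omit [DecidableEq ι] in
/-- Unfolding of `pauliRot`. [cite: RudolphEtAl2025, §II B eq. (13)] -/
theorem pauliRot_eq (θ : ℝ) (G : ι → Pauli) :
    pauliRot θ G = (Real.cos (θ / 2) : ℂ) • (1 : Matrix (ι → Bool) (ι → Bool) ℂ) -
      (Complex.I * (Real.sin (θ / 2) : ℂ)) • pauliString G := rfl

/-- Even powers of a Pauli string are `1`. [folklore] -/
private theorem pauliString_pow_two_mul (G : ι → Pauli) (k : ℕ) : pauliString G ^ (2 * k) = 1 := by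
  rw [pow_mul, sq, pauliString_mul_self, one_pow]

/-- Odd powers of a Pauli string are the string. [folklore] -/
private theorem pauliString_pow_two_mul_add_one (G : ι → Pauli) (k : ℕ) :
    pauliString G ^ (2 * k + 1) = pauliString G := by
  rw [pow_succ, pauliString_pow_two_mul, one_mul]

/-- **`e^{−iθG/2} = cos(θ/2)·1 − i sin(θ/2)·G`**: the matrix exponential (Mathlib's `NormedSpace.exp`,
as a power series in the matrix algebra) of `−i(θ/2)P_G` is `pauliRot θ G` — the even terms sum to
`cos(θ/2)·1`, the odd ones to `−i sin(θ/2)·P_G`, because `P_G² = 1`.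
[cite: RudolphEtAl2025, §II B (R_G(θ) = e^{−iθG/2})] [cite: BegusicGrayChan2024, Results §Sparse Pauli dynamics (U_σ(θ) = e^{−iθσ/2})] -/
theorem exp_eq_pauliRot (θ : ℝ) (G : ι → Pauli) :
    NormedSpace.exp ((-(Complex.I * (θ / 2 : ℝ) : ℂ)) • pauliString G) = pauliRot θ G := by
  set z : ℂ := -(Complex.I * (θ / 2 : ℝ) : ℂ) with hz
  rw [congrFun (NormedSpace.exp_eq_tsum ℂ) _]
  refine HasSum.tsum_eq ?_
  have key : ∀ n : ℕ, ((Nat.factorial n : ℂ)⁻¹) • (z • pauliString G) ^ n =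
      (z ^ n / (Nat.factorial n : ℂ)) • pauliString G ^ n := by
    intro n
    rw [smul_pow, smul_smul, div_eq_inv_mul]
  simp_rw [key]
  have hz2 : z ^ 2 = -(((θ / 2 : ℝ) : ℂ) ^ 2) := by
    rw [hz, neg_sq, mul_pow, Complex.I_sq]; ring
  have he : HasSum (fun k : ℕ => (z ^ (2 * k) / (Nat.factorial (2 * k) : ℂ)) • pauliString G ^ (2 * k))
      ((Complex.cos ((θ / 2 : ℝ) : ℂ)) • (1 : Matrix (ι → Bool) (ι → Bool) ℂ)) := by
    simp_rw [pauliString_pow_two_mul]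
    refine HasSum.smul_const ?_ _
    have hfun : (fun k : ℕ => z ^ (2 * k) / (Nat.factorial (2 * k) : ℂ)) =
        fun k : ℕ => (-1) ^ k * ((θ / 2 : ℝ) : ℂ) ^ (2 * k) / (Nat.factorial (2 * k) : ℂ) := by
      funext k
      rw [pow_mul, hz2, neg_pow, ← pow_mul]
    rw [hfun]
    exact Complex.hasSum_cos _
  have ho : HasSum (fun k : ℕ => (z ^ (2 * k + 1) / (Nat.factorial (2 * k + 1) : ℂ)) •
      pauliString G ^ (2 * k + 1))
      ((-Complex.I * Complex.sin ((θ / 2 : ℝ) : ℂ)) • pauliString G) := by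
    simp_rw [pauliString_pow_two_mul_add_one]
    refine HasSum.smul_const ?_ _
    have hfun : (fun k : ℕ => z ^ (2 * k + 1) / (Nat.factorial (2 * k + 1) : ℂ)) =
        fun k : ℕ => -Complex.I *
          ((-1) ^ k * ((θ / 2 : ℝ) : ℂ) ^ (2 * k + 1) / (Nat.factorial (2 * k + 1) : ℂ)) := by
      funext k
      rw [pow_succ, pow_mul, hz2, neg_pow, ← pow_mul, hz]
      ring
    rw [hfun]
    exact (Complex.hasSum_sin _).mul_left _
  have h := HasSum.even_add_odd
    (f := fun n : ℕ => (z ^ n / (Nat.factorial n : ℂ)) • pauliString G ^ n) he ho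
  have hval : pauliRot θ G = Complex.cos ((θ / 2 : ℝ) : ℂ) • (1 : Matrix (ι → Bool) (ι → Bool) ℂ) +
      (-Complex.I * Complex.sin ((θ / 2 : ℝ) : ℂ)) • pauliString G := by
    rw [pauliRot_eq, Complex.ofReal_cos, Complex.ofReal_sin, sub_eq_add_neg, ← neg_smul, ← neg_mul]
  rw [hval]
  exact h

omit [DecidableEq ι] in
/-- `R_G(θ)` as an element `a·1 + b·P_G` of the span of `1` and `P_G`. [cite: RudolphEtAl2025, §II B eq. (13)] -/
theorem pauliRot_eq_add (θ : ℝ) (G : ι → Pauli) :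
    pauliRot θ G = (Real.cos (θ / 2) : ℂ) • (1 : Matrix (ι → Bool) (ι → Bool) ℂ) +
      (-(Complex.I * (Real.sin (θ / 2) : ℂ))) • pauliString G := by
  rw [pauliRot_eq, sub_eq_add_neg, neg_smul]

/-- Products in the commutative algebra spanned by `1` and `P_G` (`P_G² = 1`). [folklore] -/
private theorem lin_mul_lin (a b a' b' : ℂ) (G : ι → Pauli) :
    (a • (1 : Matrix (ι → Bool) (ι → Bool) ℂ) + b • pauliString G) *
        (a' • (1 : Matrix (ι → Bool) (ι → Bool) ℂ) + b' • pauliString G) =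
      (a * a' + b * b') • (1 : Matrix (ι → Bool) (ι → Bool) ℂ) + (a * b' + b * a') • pauliString G := by
  simp only [add_mul, mul_add, Matrix.smul_mul, Matrix.mul_smul, Matrix.one_mul, Matrix.mul_one,
    smul_smul, pauliString_mul_self, add_smul]
  module

/-- **One-parameter group**: `R_G(θ) R_G(φ) = R_G(θ + φ)`. [cite: RudolphEtAl2025, §II B (R_G(θ) = e^{−iθG/2})] -/
theorem pauliRot_mul_pauliRot (θ φ : ℝ) (G : ι → Pauli) :
    pauliRot θ G * pauliRot φ G = pauliRot (θ + φ) G := by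
  rw [pauliRot_eq_add, pauliRot_eq_add, lin_mul_lin, pauliRot_eq_add, add_div, Real.cos_add,
    Real.sin_add]
  push_cast
  congr 1
  · congr 1
    rw [neg_mul_neg, ← mul_assoc, mul_right_comm Complex.I _ Complex.I, Complex.I_mul_I]
    ring
  · congr 1
    ring

omit [DecidableEq ι] in
/-- `R_G(0) = 1`. [cite: RudolphEtAl2025, §II B eq. (13)] -/
theorem pauliRot_zero (G : ι → Pauli) : pauliRot 0 G = 1 := by
  simp [pauliRot_eq]

omit [DecidableEq ι] in
/-- `R_G(θ)† = R_G(−θ) = e^{iθG/2}`. [cite: RudolphEtAl2025, §II B eq. (13)] -/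
theorem conjTranspose_pauliRot (θ : ℝ) (G : ι → Pauli) : (pauliRot θ G)ᴴ = pauliRot (-θ) G := by
  rw [pauliRot_eq, pauliRot_eq, conjTranspose_sub, conjTranspose_smul, conjTranspose_smul,
    conjTranspose_one, conjTranspose_pauliString, neg_div, Real.cos_neg, Real.sin_neg]
  congr 1
  · rw [Complex.star_def, Complex.conj_ofReal]
  · rw [Complex.star_def, map_mul, Complex.conj_I, Complex.conj_ofReal]
    push_cast
    ring_nf

/-- `R_G(θ)` is unitary: `R† R = 1`. [cite: BegusicGrayChan2024, Results §Sparse Pauli dynamics (U_σ(θ) a rotation gate)] -/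
theorem conjTranspose_mul_self_pauliRot (θ : ℝ) (G : ι → Pauli) :
    (pauliRot θ G)ᴴ * pauliRot θ G = 1 := by
  rw [conjTranspose_pauliRot, pauliRot_mul_pauliRot, neg_add_cancel, pauliRot_zero]

/-- `R_G(θ)` is unitary: `R R† = 1`. [cite: BegusicGrayChan2024, Results §Sparse Pauli dynamics] -/
theorem mul_conjTranspose_self_pauliRot (θ : ℝ) (G : ι → Pauli) :
    pauliRot θ G * (pauliRot θ G)ᴴ = 1 := by
  rw [conjTranspose_pauliRot, pauliRot_mul_pauliRot, add_neg_cancel, pauliRot_zero]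

/-! ### Heisenberg action and the branching rule -/

/-- The **Heisenberg action** of the rotation on an operator, `R_G(θ)[M] := e^{iθG/2} M e^{−iθG/2}
= R_G(θ)† M R_G(θ)` (BGC's `U_σ(θ)† O U_σ(θ)`). [cite: RudolphEtAl2025, §II B eq. (13)] [cite: BegusicGrayChan2024, Results §Sparse Pauli dynamics] -/
def rotConj (θ : ℝ) (G : ι → Pauli) (M : Matrix (ι → Bool) (ι → Bool) ℂ) :
    Matrix (ι → Bool) (ι → Bool) ℂ :=
  (pauliRot θ G)ᴴ * M * pauliRot θ G

/-- Unfolding of `rotConj`. [cite: RudolphEtAl2025, §II B eq. (13)] -/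
theorem rotConj_eq (θ : ℝ) (G : ι → Pauli) (M : Matrix (ι → Bool) (ι → Bool) ℂ) :
    rotConj θ G M = (pauliRot θ G)ᴴ * M * pauliRot θ G := rfl

/-- Expansion of `(a'·1 + b'·G) M (a·1 + b·G)`. [folklore] -/
private theorem sandwich_expand (a' b' a b : ℂ) (G : ι → Pauli) (M : Matrix (ι → Bool) (ι → Bool) ℂ) :
    (a' • (1 : Matrix (ι → Bool) (ι → Bool) ℂ) + b' • pauliString G) * M *
        (a • (1 : Matrix (ι → Bool) (ι → Bool) ℂ) + b • pauliString G) =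
      (a' * a) • M + (a' * b) • (M * pauliString G) + (b' * a) • (pauliString G * M) +
        (b' * b) • (pauliString G * M * pauliString G) := by
  simp only [add_mul, mul_add, Matrix.smul_mul, Matrix.mul_smul, Matrix.one_mul, Matrix.mul_one,
    smul_smul]
  module

/-- `(a'·1 + b'·G) P_S (a·1 + b·G)` in the basis `{P_S, P_G P_S}`, using `P_S P_G = ±P_G P_S` and
`P_G P_S P_G = ±P_S`. [folklore] -/
private theorem sandwich_pauliString (a' b' a b : ℂ) (G S : ι → Pauli) :
    (a' • (1 : Matrix (ι → Bool) (ι → Bool) ℂ) + b' • pauliString G) * pauliString S *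
        (a • (1 : Matrix (ι → Bool) (ι → Bool) ℂ) + b • pauliString G) =
      (a' * a + b' * b * strSign G S) • pauliString S +
        (a' * b * strSign G S + b' * a) • (pauliString G * pauliString S) := by
  rw [sandwich_expand, pauliString_conj_eq_strSign_smul G S, pauliString_mul_comm_smul S G,
    strSign_comm S G]
  simp only [smul_smul]
  module

/-- **The branching rule, both cases at once**: with `σ = strSign G S ∈ {±1}` (`+1` iff `G, S`
commute), `R_G(θ)[P_S] = (cos²(θ/2) + σ sin²(θ/2))·P_S + i cos(θ/2) sin(θ/2)(1 − σ)·P_G P_S`.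
[cite: RudolphEtAl2025, §II B eq. (14)] [cite: BegusicGrayChan2024, Results §Sparse Pauli dynamics (display for U_σ(θ)† P U_σ(θ))] -/
theorem rotConj_pauliString (θ : ℝ) (G S : ι → Pauli) :
    rotConj θ G (pauliString S) =
      ((Real.cos (θ / 2) : ℂ) ^ 2 + strSign G S * (Real.sin (θ / 2) : ℂ) ^ 2) • pauliString S +
        (Complex.I * (Real.cos (θ / 2) : ℂ) * (Real.sin (θ / 2) : ℂ) * (1 - strSign G S)) •
          (pauliString G * pauliString S) := by
  rw [rotConj_eq, conjTranspose_pauliRot, pauliRot_eq_add, pauliRot_eq_add, neg_div, Real.cos_neg,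
    Real.sin_neg, sandwich_pauliString]
  simp only [Complex.ofReal_neg]
  congr 1
  · congr 1
    linear_combination (-(strSign G S) * ((Real.sin (θ / 2) : ℂ)) ^ 2) * Complex.I_sq
  · congr 1
    ring

/-- `cos²(θ/2) + sin²(θ/2) = 1` in `ℂ`. [folklore] -/
private theorem cos_sq_add_sin_sq_half (θ : ℝ) :
    (Real.cos (θ / 2) : ℂ) ^ 2 + (Real.sin (θ / 2) : ℂ) ^ 2 = 1 := by
  exact_mod_cast Real.cos_sq_add_sin_sq (θ / 2)

/-- `cos²(θ/2) − sin²(θ/2) = cos θ` in `ℂ`. [folklore] -/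
private theorem cos_sq_sub_sin_sq_half (θ : ℝ) :
    (Real.cos (θ / 2) : ℂ) ^ 2 - (Real.sin (θ / 2) : ℂ) ^ 2 = Real.cos θ := by
  have h : Real.cos θ = Real.cos (θ / 2) ^ 2 - Real.sin (θ / 2) ^ 2 := by
    rw [← Real.cos_two_mul', mul_div_cancel₀ θ two_ne_zero]
  exact_mod_cast h.symm

/-- `2 cos(θ/2) sin(θ/2) = sin θ` in `ℂ`. [folklore] -/
private theorem two_mul_cos_mul_sin_half (θ : ℝ) :
    2 * (Real.cos (θ / 2) : ℂ) * (Real.sin (θ / 2) : ℂ) = Real.sin θ := by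
  have h : Real.sin θ = 2 * Real.sin (θ / 2) * Real.cos (θ / 2) := by
    rw [← Real.sin_two_mul, mul_div_cancel₀ θ two_ne_zero]
  push_cast [h]
  ring

/-- **Eq. (14), commuting case** ('R_G(θ)[P] = P if [P,G] = 0'; BGC: 'P, [σ,P] = 0'):
1-branching. [cite: RudolphEtAl2025, §II B eq. (14)] [cite: BegusicGrayChan2024, Results §Sparse Pauli dynamics] -/
theorem rotConj_pauliString_of_comm (θ : ℝ) {G S : ι → Pauli} (h : strSign G S = 1) :
    rotConj θ G (pauliString S) = pauliString S := by
  rw [rotConj_pauliString, h, one_mul, cos_sq_add_sin_sq_half, one_smul, sub_self, mul_zero,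
    zero_smul, add_zero]

/-- **Eq. (14), anticommuting case** ('cos(θ)P + sin(θ)P′, P′ = i[G,P]/2'; BGC:
'cos(θ) P + i sin(θ) σP, {σ,P} = 0'): 2-branching. [cite: RudolphEtAl2025, §II B eq. (14)] [cite: BegusicGrayChan2024, Results §Sparse Pauli dynamics] -/
theorem rotConj_pauliString_of_anticomm (θ : ℝ) {G S : ι → Pauli} (h : strSign G S = -1) :
    rotConj θ G (pauliString S) =
      (Real.cos θ : ℂ) • pauliString S +
        (Complex.I * (Real.sin θ : ℂ)) • (pauliString G * pauliString S) := by
  rw [rotConj_pauliString, h, ← cos_sq_sub_sin_sq_half θ, ← two_mul_cos_mul_sin_half θ]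
  congr 1
  · congr 1; ring
  · congr 1; ring

/-- **Clifford angles do not branch**: at `θ = π/2` an anticommuting string is mapped to the single
string `iGP` ("if the rotation gate is Clifford, meaning that `θ = kπ/2` for integer `k`, only one of
the terms in the right-hand side … will remain and the number of Paulis will not increase").
[cite: BegusicGrayChan2024, Results §Sparse Pauli dynamics (sentence after the display)] -/
theorem rotConj_pauliString_half_pi_of_anticomm {G S : ι → Pauli} (h : strSign G S = -1) :
    rotConj (Real.pi / 2) G (pauliString S) = Complex.I • (pauliString G * pauliString S) := by
  rw [rotConj_pauliString_of_anticomm _ h, Real.cos_pi_div_two, Real.sin_pi_div_two]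
  simp

/-- At `θ = π` (also Clifford) every string is mapped to `±` itself: `R_G(π)[P_S] = σ·P_S` with
`σ = strSign G S`. [cite: BegusicGrayChan2024, Results §Sparse Pauli dynamics (θ = kπ/2 does not branch)] -/
theorem rotConj_pauliString_pi (G S : ι → Pauli) :
    rotConj Real.pi G (pauliString S) = strSign G S • pauliString S := by
  rw [rotConj_pauliString, Real.cos_pi_div_two, Real.sin_pi_div_two]
  simp

/-! ### The new string `P' = i[G,P]/2 = i G P` -/

/-- For anticommuting `G, P`: `iGP = i[G,P]/2` — the two printed forms of the new term agree.
[cite: RudolphEtAl2025, §II B eq. (14) (P′ = i[G,P]/2)] [cite: BegusicGrayChan2024, Results §Sparse Pauli dynamics (i sin θ σP)] -/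
theorem I_smul_mul_eq_half_commutator {G S : ι → Pauli} (h : strSign G S = -1) :
    Complex.I • (pauliString G * pauliString S) =
      (Complex.I / 2) • (pauliString G * pauliString S - pauliString S * pauliString G) := by
  rw [pauliString_mul_comm_smul S G, strSign_comm S G, h]
  module

/-- The new term as a labelled string: `iGP = (i · stringPhase G P) · P_{G·P}` (BGC store 'integer
phases q so that P = (−i)^q ∏ Z^z X^x'). [cite: BegusicGrayChan2024, Methods (Pauli operators as 2n bit strings and integer phases)] -/
theorem I_smul_mul_eq_smul_stringMul (G S : ι → Pauli) :
    Complex.I • (pauliString G * pauliString S) =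
      (Complex.I * stringPhase G S) • pauliString (stringMul G S) := by
  rw [pauliString_mul, smul_smul]

/-- `(iGP)² = 1` for anticommuting `G, P` ('P′ … is a new Pauli string'). [cite: RudolphEtAl2025, §II B eq. (14)] -/
theorem I_smul_mul_sq {G S : ι → Pauli} (h : strSign G S = -1) :
    (Complex.I • (pauliString G * pauliString S)) * (Complex.I • (pauliString G * pauliString S)) = 1 := by
  rw [Matrix.smul_mul, Matrix.mul_smul, smul_smul,
    show pauliString G * pauliString S * (pauliString G * pauliString S) =
      pauliString G * (pauliString S * pauliString G) * pauliString S by simp only [Matrix.mul_assoc],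
    pauliString_mul_comm_smul S G, strSign_comm S G, h, Matrix.mul_smul, Matrix.smul_mul,
    show pauliString G * (pauliString G * pauliString S) * pauliString S =
      pauliString G * pauliString G * (pauliString S * pauliString S) by simp only [Matrix.mul_assoc],
    pauliString_mul_self, pauliString_mul_self, Matrix.mul_one, smul_smul, Complex.I_mul_I]
  norm_num

/-- `iGP` is Hermitian for anticommuting `G, P`. [cite: RudolphEtAl2025, §II B eq. (14)] -/
theorem conjTranspose_I_smul_mul {G S : ι → Pauli} (h : strSign G S = -1) :
    (Complex.I • (pauliString G * pauliString S))ᴴ = Complex.I • (pauliString G * pauliString S) := by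
  rw [conjTranspose_smul, conjTranspose_mul, conjTranspose_pauliString, conjTranspose_pauliString,
    pauliString_mul_comm_smul S G, strSign_comm S G, h, Complex.star_def, Complex.conj_I, smul_smul]
  norm_num

/-- The phase `i · stringPhase G P` squares to `1` for anticommuting `G, P`. [cite: RudolphEtAl2025, §II B eq. (14) (P′ is a Pauli string)] -/
theorem I_mul_stringPhase_sq {G S : ι → Pauli} (h : strSign G S = -1) :
    (Complex.I * stringPhase G S) ^ 2 = 1 := by
  have h1 := I_smul_mul_sq h
  rw [I_smul_mul_eq_smul_stringMul, Matrix.smul_mul, Matrix.mul_smul, smul_smul,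
    pauliString_mul_self, ← sq] at h1
  have h2 := congrFun (congrFun h1 (fun _ => false)) (fun _ => false)
  simpa using h2

/-- **`P′ = ±P_{G·P}`**: for anticommuting `G, P` the phase `i · stringPhase G P` is `1` or `−1`.
[cite: RudolphEtAl2025, §II B eq. (14) ('P′ = i[G,P]/2 is a new Pauli string')] -/
theorem I_mul_stringPhase_eq_or {G S : ι → Pauli} (h : strSign G S = -1) :
    Complex.I * stringPhase G S = 1 ∨ Complex.I * stringPhase G S = -1 := by
  have h1 := I_mul_stringPhase_sq h
  rwa [sq, mul_self_eq_one_iff] at h1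

/-! ### Coefficient update rule -/

omit [Fintype ι] [DecidableEq ι] in
/-- The letter product is commutative (Klein four-group). [folklore] -/
private theorem letterMul_comm (Q P : Pauli) : Q.letterMul P = P.letterMul Q := by
  cases Q <;> cases P <;> rfl

omit [Fintype ι] [DecidableEq ι] in
/-- Multiplying twice by the same letter is the identity. [folklore] -/
private theorem letterMul_letterMul_self (Q P : Pauli) : Q.letterMul (Q.letterMul P) = P := by
  cases Q <;> cases P <;> rfl

omit [Fintype ι] [DecidableEq ι] in
/-- `phase(Q,P) = sign(Q,P) · phase(P,Q)` (`σ_Q σ_P = ± σ_P σ_Q`). [folklore] -/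
private theorem letterPhase_comm (Q P : Pauli) : Q.letterPhase P = Pauli.sign Q P * P.letterPhase Q := by
  cases Q <;> cases P <;> simp [Pauli.letterPhase, Pauli.sign]

omit [Fintype ι] [DecidableEq ι] in
/-- The label product of strings is commutative. [folklore] -/
private theorem stringMul_comm (G T : ι → Pauli) : stringMul G T = stringMul T G := by
  funext i; exact letterMul_comm _ _

omit [Fintype ι] [DecidableEq ι] in
/-- `G·(G·T) = T` on labels. [folklore] -/
private theorem stringMul_stringMul_self (G T : ι → Pauli) : stringMul G (stringMul G T) = T := by
  funext i; exact letterMul_letterMul_self _ _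

omit [DecidableEq ι] in
/-- `phase(G,T) = strSign(G,T) · phase(T,G)` (`P_G P_T = ± P_T P_G`). [folklore] -/
private theorem stringPhase_comm (G T : ι → Pauli) : stringPhase G T = strSign G T * stringPhase T G := by
  rw [stringPhase, stringPhase, strSign_eq, ← Finset.prod_mul_distrib]
  exact Finset.prod_congr rfl fun i _ => letterPhase_comm _ _

/-- `Tr(P_T · P_W N P_W) = strSign(W,T) Tr(P_T N)`. [folklore] -/
private theorem pauliCoeff_conj' (W : ι → Pauli) (N : Matrix (ι → Bool) (ι → Bool) ℂ) (T : ι → Pauli) :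
    pauliCoeff (pauliString W * N * pauliString W) T = strSign W T * pauliCoeff N T := by
  rw [pauliCoeff_eq, pauliCoeff_eq, show pauliString T * (pauliString W * N * pauliString W) =
      (pauliString T * pauliString W * N) * pauliString W by simp only [Matrix.mul_assoc],
    Matrix.trace_mul_comm, show pauliString W * (pauliString T * pauliString W * N) =
      (pauliString W * pauliString T * pauliString W) * N by simp only [Matrix.mul_assoc],
    pauliString_conj_eq_strSign_smul, Matrix.smul_mul, Matrix.trace_smul, smul_eq_mul]

/-- Left multiplication by `P_G` permutes the Pauli coefficients: `Tr(P_T P_G M) = phase(T,G)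
Tr(P_{G·T} M)`. [cite: BegusicGrayChan2024, Methods (a_{σP})] -/
theorem pauliCoeff_pauliString_mul (G : ι → Pauli) (M : Matrix (ι → Bool) (ι → Bool) ℂ) (T : ι → Pauli) :
    pauliCoeff (pauliString G * M) T = stringPhase T G * pauliCoeff M (stringMul G T) := by
  rw [pauliCoeff_eq, pauliCoeff_eq, ← Matrix.mul_assoc, pauliString_mul, Matrix.smul_mul,
    Matrix.trace_smul, smul_eq_mul, stringMul_comm]

/-- Right multiplication by `P_G`: `Tr(P_T M P_G) = phase(G,T) Tr(P_{G·T} M)`. [cite: BegusicGrayChan2024, Methods (a_{σP})] -/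
theorem pauliCoeff_mul_pauliString (G : ι → Pauli) (M : Matrix (ι → Bool) (ι → Bool) ℂ) (T : ι → Pauli) :
    pauliCoeff (M * pauliString G) T = stringPhase G T * pauliCoeff M (stringMul G T) := by
  rw [pauliCoeff_eq, pauliCoeff_eq, ← Matrix.mul_assoc, Matrix.trace_mul_cycle, pauliString_mul,
    Matrix.smul_mul, Matrix.trace_smul, smul_eq_mul]

/-- **Coefficient update rule, general form**: with `σ = strSign G T`,
`Tr(P_T R†MR) = (cos²(θ/2) + σ sin²(θ/2)) Tr(P_T M) + i cos(θ/2) sin(θ/2)(1 − σ)·phase(T,G)·Tr(P_{G·T} M)`.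
[cite: BegusicGrayChan2024, Methods (display for a′_P)] -/
theorem pauliCoeff_rotConj (θ : ℝ) (G : ι → Pauli) (M : Matrix (ι → Bool) (ι → Bool) ℂ)
    (T : ι → Pauli) :
    pauliCoeff (rotConj θ G M) T =
      ((Real.cos (θ / 2) : ℂ) ^ 2 + strSign G T * (Real.sin (θ / 2) : ℂ) ^ 2) * pauliCoeff M T +
        Complex.I * (Real.cos (θ / 2) : ℂ) * (Real.sin (θ / 2) : ℂ) * (1 - strSign G T) *
          stringPhase T G * pauliCoeff M (stringMul G T) := by
  rw [rotConj_eq, conjTranspose_pauliRot, pauliRot_eq_add, pauliRot_eq_add, neg_div, Real.cos_neg,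
    Real.sin_neg, sandwich_expand]
  simp only [Complex.ofReal_neg]
  rw [pauliCoeff_add, pauliCoeff_add, pauliCoeff_add, pauliCoeff_smul, pauliCoeff_smul, pauliCoeff_smul,
    pauliCoeff_smul, pauliCoeff_conj', pauliCoeff_pauliString_mul, pauliCoeff_mul_pauliString,
    stringPhase_comm G T]
  linear_combination (-(strSign G T) * ((Real.sin (θ / 2) : ℂ)) ^ 2 * pauliCoeff M T) * Complex.I_sq

/-- **`a′_P = a_P` for `[σ,P] = 0`.** [cite: BegusicGrayChan2024, Methods (a′_P = a_P, [σ,P] = 0)] -/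
theorem pauliCoeff_rotConj_of_comm (θ : ℝ) (G : ι → Pauli) (M : Matrix (ι → Bool) (ι → Bool) ℂ)
    {T : ι → Pauli} (h : strSign G T = 1) : pauliCoeff (rotConj θ G M) T = pauliCoeff M T := by
  rw [pauliCoeff_rotConj, h, one_mul, cos_sq_add_sin_sq_half, one_mul, sub_self]
  ring

/-- **`a′_P = a_P cos θ + i a_{σP} sin θ` for `{σ,P} = 0`** (the coefficient of the operator `σP`,
here `phase(P,σ) · Tr(P_{σ·P} M)` with the phase explicit). [cite: BegusicGrayChan2024, Methods (a′_P = a_P cos θ + i a_{σP} sin θ)] -/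
theorem pauliCoeff_rotConj_of_anticomm (θ : ℝ) (G : ι → Pauli) (M : Matrix (ι → Bool) (ι → Bool) ℂ)
    {T : ι → Pauli} (h : strSign G T = -1) :
    pauliCoeff (rotConj θ G M) T = (Real.cos θ : ℂ) * pauliCoeff M T +
      Complex.I * (Real.sin θ : ℂ) * stringPhase T G * pauliCoeff M (stringMul G T) := by
  rw [pauliCoeff_rotConj, h, ← cos_sq_sub_sin_sq_half θ, ← two_mul_cos_mul_sin_half θ]
  ring

/-! ### Support and branching count -/

/-- The label set `𝒫 = {P : a_P ≠ 0}` of an operator's Pauli representation (its cardinality is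
`N_O`, 'the number of non-zero-coefficient Pauli strings'). [cite: RudolphEtAl2025, §II eq. (3)] [cite: BegusicGrayChan2024, Results §Sparse Pauli dynamics (O = Σ_{P∈𝒫} a_P P)] -/
def pauliSupport (M : Matrix (ι → Bool) (ι → Bool) ℂ) : Finset (ι → Pauli) :=
  Finset.univ.filter fun S => pauliCoeff M S ≠ 0

/-- Membership in `pauliSupport`. [cite: RudolphEtAl2025, §II eq. (3)] -/
theorem mem_pauliSupport {M : Matrix (ι → Bool) (ι → Bool) ℂ} {S : ι → Pauli} :
    S ∈ pauliSupport M ↔ pauliCoeff M S ≠ 0 := by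
  simp [pauliSupport]

/-- **`𝒫′ ⊆ 𝒫 ∪ {σP | P ∈ 𝒫}`**: every label of `R†OR` is an old label or `G` times an old label.
[cite: BegusicGrayChan2024, Methods (𝒫′ = 𝒫 ∪ {σP | P ∈ 𝒫, {σ,P} = 0})] -/
theorem pauliSupport_rotConj_subset (θ : ℝ) (G : ι → Pauli) (M : Matrix (ι → Bool) (ι → Bool) ℂ) :
    pauliSupport (rotConj θ G M) ⊆ pauliSupport M ∪ (pauliSupport M).image (stringMul G) := by
  intro T hT
  rw [mem_pauliSupport, pauliCoeff_rotConj] at hT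
  rw [Finset.mem_union, mem_pauliSupport, Finset.mem_image]
  by_cases h1 : pauliCoeff M T = 0
  · right
    refine ⟨stringMul G T, ?_, stringMul_stringMul_self G T⟩
    rw [mem_pauliSupport]
    intro h2
    apply hT
    rw [h1, h2, mul_zero, mul_zero, add_zero]
  · left; exact h1

/-- **2-branching**: `|𝒫′| ≤ 2|𝒫|` ('A Pauli rotation is always either 1-branching … or
2-branching'; '2|𝒫| ≥ |𝒫′|'). [cite: RudolphEtAl2025, §II B] [cite: BegusicGrayChan2024, Methods (2|𝒫| ≥ |𝒫′|)] -/
theorem card_pauliSupport_rotConj_le (θ : ℝ) (G : ι → Pauli) (M : Matrix (ι → Bool) (ι → Bool) ℂ) :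
    (pauliSupport (rotConj θ G M)).card ≤ 2 * (pauliSupport M).card :=
  calc (pauliSupport (rotConj θ G M)).card
      ≤ (pauliSupport M ∪ (pauliSupport M).image (stringMul G)).card :=
        Finset.card_le_card (pauliSupport_rotConj_subset θ G M)
    _ ≤ (pauliSupport M).card + ((pauliSupport M).image (stringMul G)).card := Finset.card_union_le _ _
    _ ≤ (pauliSupport M).card + (pauliSupport M).card :=
        Nat.add_le_add_left Finset.card_image_le _
    _ = 2 * (pauliSupport M).card := by ring

/-- Propagation through a list of rotations `(θ₁,G₁), …, (θ_m,G_m)` (head applied last, i.e.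
`R₁†(⋯(R_m† O R_m)⋯)R₁`). [cite: RudolphEtAl2025, §II eq. (8) (E[O] = E_1[…[E_m[O]]])] -/
def rotConjList (L : List (ℝ × (ι → Pauli))) (M : Matrix (ι → Bool) (ι → Bool) ℂ) :
    Matrix (ι → Bool) (ι → Bool) ℂ :=
  L.foldr (fun g N => rotConj g.1 g.2 N) M

/-- **'a circuit composed of m Pauli rotations can generate up to 2^m Pauli strings'**:
`|𝒫_m| ≤ 2^m |𝒫_0|` (BGC: 'worst-case scaling of 𝒪(2^N)'). [cite: RudolphEtAl2025, §II B (sentence after eq. (14))] [cite: BegusicGrayChan2024, Methods] -/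
theorem card_pauliSupport_rotConjList_le (L : List (ℝ × (ι → Pauli)))
    (M : Matrix (ι → Bool) (ι → Bool) ℂ) :
    (pauliSupport (rotConjList L M)).card ≤ 2 ^ L.length * (pauliSupport M).card := by
  induction L with
  | nil => simp [rotConjList]
  | cons g L ih =>
    calc (pauliSupport (rotConjList (g :: L) M)).card
        ≤ 2 * (pauliSupport (rotConjList L M)).card := card_pauliSupport_rotConj_le g.1 g.2 _
      _ ≤ 2 * (2 ^ L.length * (pauliSupport M).card) := Nat.mul_le_mul_left 2 ih
      _ = 2 ^ (g :: L).length * (pauliSupport M).card := by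
          rw [List.length_cons, pow_succ]; ring

/-- A single Pauli string has label set `⊆ {S}` (so `m` rotations on one string give `≤ 2^m`
labels). [cite: RudolphEtAl2025, §II eq. (3)] -/
theorem pauliSupport_pauliString_subset (S : ι → Pauli) : pauliSupport (pauliString S) ⊆ {S} := by
  intro T hT
  rw [mem_pauliSupport, pauliCoeff_eq, trace_pauliString_mul_pauliString] at hT
  rw [Finset.mem_singleton]
  by_contra hne
  exact hT (if_neg hne)

/-! ### 2-norm conservation -/

/-- Hilbert–Schmidt norm as a trace. [folklore] -/
private theorem sum_norm_sq_eq_re_trace' (N : Matrix (ι → Bool) (ι → Bool) ℂ) :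
    ∑ x, ∑ y, ‖N x y‖ ^ 2 = (N * Nᴴ).trace.re := by
  have : ((∑ x, ∑ y, ‖N x y‖ ^ 2 : ℝ) : ℂ) = (N * Nᴴ).trace := by
    simp [Matrix.trace, Matrix.mul_apply, Complex.mul_conj']
  rw [← this, Complex.ofReal_re]

/-- **'the 2-norm of the observable … Σ_α c_α² – is conserved'** under a rotation: for any `M`,
`Σ_S |Tr(P_S R†MR)|² = Σ_S |Tr(P_S M)|²` (Parseval `sum_norm_pauliCoeff_sq` + unitary invariance of
`Tr(M M†)`; 'sin(θ)² + cos(θ)² = 1'). [cite: RudolphEtAl2025, §III C (p. 13: 2-norm conserved; p. 14: sin² + cos² = 1)] -/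
theorem sum_norm_pauliCoeff_sq_rotConj (θ : ℝ) (G : ι → Pauli) (M : Matrix (ι → Bool) (ι → Bool) ℂ) :
    ∑ S, ‖pauliCoeff (rotConj θ G M) S‖ ^ 2 = ∑ S, ‖pauliCoeff M S‖ ^ 2 := by
  rw [sum_norm_pauliCoeff_sq, sum_norm_pauliCoeff_sq, sum_norm_sq_eq_re_trace',
    sum_norm_sq_eq_re_trace']
  congr 2
  rw [rotConj_eq, conjTranspose_mul, conjTranspose_mul, conjTranspose_conjTranspose,
    show (pauliRot θ G)ᴴ * M * pauliRot θ G * ((pauliRot θ G)ᴴ * (Mᴴ * pauliRot θ G)) =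
      (pauliRot θ G)ᴴ * M * (pauliRot θ G * (pauliRot θ G)ᴴ) * Mᴴ * pauliRot θ G by
        simp only [Matrix.mul_assoc],
    mul_conjTranspose_self_pauliRot, Matrix.mul_one,
    Matrix.trace_mul_cycle, show pauliRot θ G * ((pauliRot θ G)ᴴ * M) * Mᴴ =
      (pauliRot θ G * (pauliRot θ G)ᴴ) * (M * Mᴴ) by simp only [Matrix.mul_assoc],
    mul_conjTranspose_self_pauliRot, Matrix.one_mul]

/-! ### Truncation (Box 3) -/

/-- **Truncation to a label set** `K`: `Π_K(O) = Σ_{P∈K} a_P P` (BGC's `Π_δ` is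
`K = {P : |a_P| ≥ δ}`; Rudolph et al.'s coefficient / weight truncations are other choices of `K`).
[cite: BegusicGrayChan2024, Methods (Π_δ)] [cite: RudolphEtAl2025, Theory Box 3] -/
def truncateTo (K : Finset (ι → Pauli)) (M : Matrix (ι → Bool) (ι → Bool) ℂ) :
    Matrix (ι → Bool) (ι → Bool) ℂ :=
  ((2 : ℂ) ^ Fintype.card ι)⁻¹ • ∑ S ∈ K, pauliCoeff M S • pauliString S

/-- Coefficients of the truncation: kept labels keep `a_P`, dropped ones get `0`.
[cite: BegusicGrayChan2024, Methods (Π_δ)] -/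
theorem pauliCoeff_truncateTo (K : Finset (ι → Pauli)) (M : Matrix (ι → Bool) (ι → Bool) ℂ)
    (T : ι → Pauli) :
    pauliCoeff (truncateTo K M) T = if T ∈ K then pauliCoeff M T else 0 := by
  have h2 : ((2 : ℂ) ^ Fintype.card ι) ≠ 0 := pow_ne_zero _ two_ne_zero
  rw [truncateTo, pauliCoeff_smul, pauliCoeff_sum]
  simp only [pauliCoeff_smul, pauliCoeff_eq (pauliString _), trace_pauliString_mul_pauliString,
    mul_ite, mul_zero]
  rw [Finset.sum_ite_eq K T]  -- careful with orientation
  split_ifs with hT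
  · field_simp
  · simp

/-- The discarded part `O − Π_K O = Σ_{P ∉ K} a_P P`. [cite: RudolphEtAl2025, Theory Box 3 ('truncated Paulis')] -/
theorem sub_truncateTo_eq (K : Finset (ι → Pauli)) (M : Matrix (ι → Bool) (ι → Bool) ℂ) :
    M - truncateTo K M =
      ((2 : ℂ) ^ Fintype.card ι)⁻¹ • ∑ S ∈ Finset.univ \ K, pauliCoeff M S • pauliString S := by
  refine eq_of_forall_pauliCoeff_eq fun T => ?_
  rw [pauliCoeff_sub, pauliCoeff_truncateTo,
    show ((2 : ℂ) ^ Fintype.card ι)⁻¹ • ∑ S ∈ Finset.univ \ K, pauliCoeff M S • pauliString S =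
      truncateTo (Finset.univ \ K) M from rfl, pauliCoeff_truncateTo]
  simp only [Finset.mem_sdiff, Finset.mem_univ, true_and]
  split_ifs <;> simp

/-- **Theory Box 3, eqs. (31)–(32)**: for any `ρ` with `|Tr(P_S ρ)| ≤ 1` for every `S` (every
density matrix), `|Tr[(O − Π_K O) ρ]| ≤ Σ_{S ∉ K} |a_S|` — 'We can upper bound the truncation error
via the triangle inequality … ≤ Σ_{truncated Paulis} |c_α| =: Δ_L' (a worst-case bound; the
ℓ₂ / average-case refinements of the Box are not formalised). [cite: RudolphEtAl2025, Theory Box 3 eqs. (31)–(32)] -/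
theorem norm_trace_sub_truncateTo_mul_le (K : Finset (ι → Pauli)) (M ρ : Matrix (ι → Bool) (ι → Bool) ℂ)
    (hρ : ∀ S, ‖pauliCoeff ρ S‖ ≤ 1) :
    ‖((M - truncateTo K M) * ρ).trace‖ ≤
      ((2 : ℝ) ^ Fintype.card ι)⁻¹ * ∑ S ∈ Finset.univ \ K, ‖pauliCoeff M S‖ := by
  rw [sub_truncateTo_eq, Matrix.smul_mul, Matrix.trace_smul, Finset.sum_mul, Matrix.trace_sum]
  simp only [Matrix.smul_mul, Matrix.trace_smul, smul_eq_mul]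
  rw [norm_mul, norm_inv, norm_pow, Complex.norm_two]
  refine mul_le_mul_of_nonneg_left ((norm_sum_le _ _).trans (Finset.sum_le_sum fun S _ => ?_))
    (by positivity)
  rw [norm_mul, ← pauliCoeff_eq]
  exact mul_le_of_le_one_right (norm_nonneg _) (hρ S)

end Literature.Computability.QuantumComplexity.PauliPropagation
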